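import Summits.BirchSwinnertonDyer.BirchSwinnertonDyer.Theorems.SylvesterTwoHeegnerIndexCoupledTelescopeStep
import Literature.NumberTheory.EllipticCurves.HeegnerPointsKolyvaginPrimaryChainProofs
import Literature.NumberTheory.EllipticCurves.HeegnerPointsKolyvaginSplitDescentData
import HarnessLib

/-!
# The COUPLED Cassels–Tate telescope, II-κ: the chain and `∑ N_i ≤ M₀` with the value clauses NARROWED
# to an auxiliary pairing exponent `κ ≥ M₀` (the ranges the induction actually uses)

Variant of `…Theorems.SylvesterTwoHeegnerIndexCoupledTelescope` (p694742: `exists_coupledChain_of_casselsTate`,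
`sum_le_M₀_of_coupledCasselsTate`).  Helper toward crux `UpperOffV0HSYPlus` (stmt-BirchSwinnertonDyer-19804),
VARIANT M, stubs `stub_tailFour` / `stub_tailSeven`.

WHY.  The value clauses `hCTV_A` / `hCTV_B` of p694742 are quantified over McCallum's full «order language»
range `M - M₀ ≤ j`, `N + M₀ ≤ M`, `N ≤ j` (levels `(M - j + N, N)` of his Prop. 4.7, the LOCAL level `N`
varying with `t`).  The tree's value theorem for the CONSTRUCTED pairing,
`CasselsTateSelmerKolyvaginValue.ctLevelPairing_pullback_eq_localTerm_kolyvagin`, is RIGID: one pairing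
level `m = 2^κ`, Selmer level `m·m`, first class `z = m • (k • c)` (so `κ ≤ j`), second class killed by `m`
(so `N ≤ κ`).  Over the full range both hold only for `κ = M₀`, which would in turn require
`2^{M₀}·Ш(X_K)[2^∞] = 0` (an annihilation input nobody displays).  But the induction USES the clause only at
`(j, N, a, b) = (i, N_{k+1}, 0, N_{k+1} - 1)` with `i ≥ (M - M₀) + ∑_{j ≤ k} N_j` (invariant (I)) — so for
any `κ` with `M₀ ≤ κ` and room `N_i + κ ≤ M` the clause is needed only on `M - κ ≤ j`, `N + κ ≤ M`:
exactly the landed `coupledStep` (p693296) invoked with `M₀ := κ` (its `M₀` enters only the two ranges, the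
room and `hB₀`), while the base case keeps the TRUE `M₀` (`c_B(1) = p^{M₀}·x`, defect `M - M₀ ≥ M - κ`).
With `M = 2κ`, `κ ≥ max(M₀, e_A, e_B)` (`2^{e_X}` the exponent of `Ш(X_K)[2^∞]`) every admitted `(j, N)`
has `κ ≤ j`, `N ≤ κ` and the rigid-level theorem applies verbatim (rows' (T-L2) discharge).

MAIN RESULTS (abstract; every hypothesis displayed; NO definition, NO named fact, NO structure):
* `exists_coupledChain_of_casselsTate_kappa` — p694742's chain with invariant (I), binders VERBATIM except:
  `{κ} (hκ : M₀ ≤ κ)`; value-clause ranges `M - κ ≤ j → N + κ ≤ M → N ≤ j`; room `N i + κ ≤ M`.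
* `sum_le_M₀_of_coupledCasselsTate_kappa` — **`∑_{i=1}^{K} N_i ≤ M₀`** under the same narrowed leaves.
Theorem-only; nothing asserted on 19804; no stub closed; BSD not claimed for any curve.  Sources: McCallum
1991 (LMS LN 153) §4 Prop. 4.4/4.7, §5 Lemma 5.3, Thm. 5.4 (proof (16)–(23), p. 289: levels
`(M₀ - μ + N_i, N_i)`); MEMO-bsd-cm-two §59.1, §64.5.
-/

-- every Summits module is named `Summit.<Summit>.<Problem>…`: the duplicated component is by design
set_option linter.dupNamespace false
set_option autoImplicit false

open scoped Classical

namespace Summit.BirchSwinnertonDyer.BirchSwinnertonDyer.Theorems.SylvesterTwoCoupledTelescope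

open Literature.NumberTheory.EllipticCurves Literature.NumberTheory.EllipticCurves.KolyvaginDescent

/-! ## §2κ. The coupled chain with invariant (I), κ-narrowed value clauses -/

section ChainKappa

variable {VA VB : Type*} [AddCommGroup VA] [AddCommGroup VB] {Pl : Type*} {RA RB : Type*}
  [AddCommGroup RA] [AddCommGroup RB]

/-- **McCallum 1991, proof of Thm. 5.4 — the COUPLED chain with invariant (I), κ-NARROWED value
clauses** (memo two §64.5, STEP 1 and STEP `k → k+1`, run WITHOUT the optimality (20′), hence without
Prop. 5.2′; variant of p694742's `exists_coupledChain_of_casselsTate`).  Data (all displayed):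
an arbitrary prime `p`, a level `M` killing `V_A` and `V_B`; `𝒪`-operators `w_A`, `w_B`; Selmer groups
`Sel_X` cut out by local conditions `Loc_X v` and `w`-stable; Kolyvagin primes `Kol` with places `pl`;
strict conditions `A_X ℓ`; admissible sets `Adm_X`; the bottom class `x ∈ V_B` of order `p^M` with
`c_B(1) = p^{M₀} x`; coupled classes `c_A` (odd number of Kolyvagin primes) / `c_B` (even), admissible,
with the two FLIPs with multiples; the Cassels–Tate pairings `P_A`, `P_B` on `Sel_A`, `Sel_B` with their
value clauses `hCTV_A`, `hCTV_B`; the mixed Čebotarev clause `hCeb`; lifts `s_A i` (`i` odd) / `s_B i`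
(`i` even), `0 < i ≤ K`, admissible, of exact orders `p^{N i}` with room `N i + κ ≤ M` for an auxiliary
exponent `κ ≥ M₀` (the value clauses being required only on `M - κ ≤ j`, `N + κ ≤ M`), pairwise
`𝒪`-isotropic on each curve, and `𝒪`-independent (together with `x` on `B`).  CONCLUSION: for every
`k ≤ K` there is `n = n_k`, a square-free product of `k` Kolyvagin primes, such that the later lifts
vanish at the primes of `n` and
**(I)** `p^i c_{X_k}(n) ∈ 𝒪·⟨later lifts on X_k⟩ ⟹ (M − M₀) + ∑_{j ≤ k} N_j ≤ i`
(`X_k = B` for `k` even, `A` for `k` odd).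
[cite: McCallumLMS1991, Thm. 5.4 (proof, (16)–(23)), Prop. 4.4, Prop. 4.7, Lemma 5.3, Prop. 3.1] -/
theorem exists_coupledChain_of_casselsTate_kappa {p : ℕ} {M M₀ : ℕ} {Kol : ℕ → Prop}
    (prime_of_kol : ∀ ℓ, Kol ℓ → ℓ.Prime) {pl : ℕ → Pl}
    {SelA : AddSubgroup VA} {SelB : AddSubgroup VB} {LocA : Pl → AddSubgroup VA}
    {LocB : Pl → AddSubgroup VB} (mem_selA_iff : ∀ s, s ∈ SelA ↔ ∀ v, s ∈ LocA v)
    (mem_selB_iff : ∀ s, s ∈ SelB ↔ ∀ v, s ∈ LocB v) {AA : ℕ → AddSubgroup VA}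
    {AB : ℕ → AddSubgroup VB} (wA : VA →+ VA) (wB : VB →+ VB) (hwSelA : ∀ s ∈ SelA, wA s ∈ SelA)
    (hwSelB : ∀ s ∈ SelB, wB s ∈ SelB) {AdmA : Set VA} {AdmB : Set VB}
    -- the bottom class and the coupled Kolyvagin classes
    {x : VB} (x_ord : ((p : ℤ) ^ (M - 1)) • x ≠ 0) {cA : ℕ → VA} {cB : ℕ → VB}
    (c_one : cB 1 = ((p : ℤ) ^ M₀) • x) {κ : ℕ} (hκ : M₀ ≤ κ)
    (cA_adm : ∀ n, KolSupp Kol n → Odd n.primeFactors.card → cA n ∈ AdmA)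
    (cB_adm : ∀ n, KolSupp Kol n → Even n.primeFactors.card → cB n ∈ AdmB)
    (flipA : ∀ ℓ m, Kol ℓ → KolSupp Kol (ℓ * m) → Even m.primeFactors.card → ∀ a : ℕ,
      ((p : ℤ) ^ a) • cA (ℓ * m) ∈ LocA (pl ℓ) ↔ ((p : ℤ) ^ a) • cB m ∈ AB ℓ)
    (flipB : ∀ ℓ m, Kol ℓ → KolSupp Kol (ℓ * m) → Odd m.primeFactors.card → ∀ a : ℕ,
      ((p : ℤ) ^ a) • cB (ℓ * m) ∈ LocB (pl ℓ) ↔ ((p : ℤ) ^ a) • cA m ∈ AA ℓ)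
    -- the Cassels–Tate pairings and their value clauses (McCallum 4.7 + 5.3 + 4.4 ↦ memo (P5)+(P6)+(P2))
    (PA : SelA →+ SelA →+ RA) (PB : SelB →+ SelB →+ RB)
    (hCTVA : ∀ ℓ m : ℕ, Kol ℓ → KolSupp Kol (ℓ * m) → ¬ ℓ ∣ m → Even m.primeFactors.card →
      ∀ (j N a b : ℕ) (t : VA) (ht : t ∈ SelA) (hz : ((p : ℤ) ^ j) • cA (ℓ * m) ∈ SelA),
      ((p : ℤ) ^ N) • t = 0 → (∀ q ∈ m.primeFactors, t ∈ AA q) → M - κ ≤ j → N + κ ≤ M → N ≤ j →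
      a + b + 1 = N → ((p : ℤ) ^ (a + (j - N))) • cB m ∉ AB ℓ → ((p : ℤ) ^ b) • t ∉ AA ℓ →
      PA ⟨_, hz⟩ ⟨t, ht⟩ ≠ 0)
    (hCTVB : ∀ ℓ m : ℕ, Kol ℓ → KolSupp Kol (ℓ * m) → ¬ ℓ ∣ m → Odd m.primeFactors.card →
      ∀ (j N a b : ℕ) (t : VB) (ht : t ∈ SelB) (hz : ((p : ℤ) ^ j) • cB (ℓ * m) ∈ SelB),
      ((p : ℤ) ^ N) • t = 0 → (∀ q ∈ m.primeFactors, t ∈ AB q) → M - κ ≤ j → N + κ ≤ M → N ≤ j →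
      a + b + 1 = N → ((p : ℤ) ^ (a + (j - N))) • cA m ∉ AA ℓ → ((p : ℤ) ^ b) • t ∉ AB ℓ →
      PB ⟨_, hz⟩ ⟨t, ht⟩ ≠ 0)
    -- the MIXED Čebotarev clause (memo COROLLARY 3.2″, kernel form, admissible classes)
    (hCeb : ∀ (TA : Finset VA) (TB : Finset VB) (gA : VA) (gB : VB), gA ∈ AdmA → gB ∈ AdmB →
      (TA : Set VA) ⊆ AdmA → (TB : Set VB) ⊆ AdmB → ∀ b : ℕ, ∃ ℓ, b < ℓ ∧ Kol ℓ ∧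
      (∀ g ∈ AddSubgroup.closure (insert gA (insert (wA gA) ((TA : Set VA) ∪ wA '' (TA : Set VA)))),
        g ∈ AA ℓ ↔ g ∈ AddSubgroup.closure ((TA : Set VA) ∪ wA '' (TA : Set VA))) ∧
      (∀ g ∈ AddSubgroup.closure (insert gB (insert (wB gB) ((TB : Set VB) ∪ wB '' (TB : Set VB)))),
        g ∈ AB ℓ ↔ g ∈ AddSubgroup.closure ((TB : Set VB) ∪ wB '' (TB : Set VB))))
    -- the lifts
    (K : ℕ) (sA : ℕ → VA) (sB : ℕ → VB) (N : ℕ → ℕ) (hselA : ∀ i, sA i ∈ SelA)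
    (hselB : ∀ i, sB i ∈ SelB) (sA_adm : ∀ i, sA i ∈ AdmA) (sB_adm : ∀ i, sB i ∈ AdmB)
    (hNA : ∀ i, Odd i → ((p : ℤ) ^ N i) • sA i = 0) (hNB : ∀ i, Even i → ((p : ℤ) ^ N i) • sB i = 0)
    (hNA' : ∀ i ∈ Finset.Ioc 0 K, Odd i → N i ≠ 0 → ((p : ℤ) ^ (N i - 1)) • sA i ≠ 0)
    (hNB' : ∀ i ∈ Finset.Ioc 0 K, Even i → N i ≠ 0 → ((p : ℤ) ^ (N i - 1)) • sB i ≠ 0)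
    (hroom : ∀ i ∈ Finset.Ioc 0 K, N i + κ ≤ M)
    (hisoA : ∀ i i', Odd i → Odd i' →
      PA ⟨sA i, hselA i⟩ ⟨sA i', hselA i'⟩ = 0 ∧ PA ⟨wA (sA i), hwSelA _ (hselA i)⟩ ⟨sA i', hselA i'⟩ = 0)
    (hisoB : ∀ i i', Even i → Even i' →
      PB ⟨sB i, hselB i⟩ ⟨sB i', hselB i'⟩ = 0 ∧ PB ⟨wB (sB i), hwSelB _ (hselB i)⟩ ⟨sB i', hselB i'⟩ = 0)
    (hindA : ∀ (α β : ℕ → ℤ),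
      ∑ j ∈ (Finset.Ioc 0 K).filter (fun j ↦ Odd j), (α j • sA j + β j • wA (sA j)) = 0 →
        ∀ j ∈ (Finset.Ioc 0 K).filter (fun j ↦ Odd j), α j • sA j + β j • wA (sA j) = 0)
    (hindB : ∀ (b c : ℤ) (α β : ℕ → ℤ),
      (b • x + c • wB x) +
          ∑ j ∈ (Finset.Ioc 0 K).filter (fun j ↦ Even j), (α j • sB j + β j • wB (sB j)) = 0 →
        b • x + c • wB x = 0 ∧
          ∀ j ∈ (Finset.Ioc 0 K).filter (fun j ↦ Even j), α j • sB j + β j • wB (sB j) = 0)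
    (k : ℕ) (hk : k ≤ K) :
    ∃ n, KolSupp Kol n ∧ n.primeFactors.card = k ∧
      (∀ q ∈ n.primeFactors, (∀ j ∈ Finset.Ioc k K, Odd j → sA j ∈ AA q) ∧
        (∀ j ∈ Finset.Ioc k K, Even j → sB j ∈ AB q)) ∧
      (Even k → ∀ i : ℕ, ((p : ℤ) ^ i) • cB n ∈ AddSubgroup.closure
          (((((Finset.Ioc k K).filter (fun j ↦ Even j)).image sB : Finset VB) : Set VB) ∪
            wB '' ((((Finset.Ioc k K).filter (fun j ↦ Even j)).image sB : Finset VB) : Set VB)) →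
        (M - M₀) + ∑ j ∈ Finset.Ioc 0 k, N j ≤ i) ∧
      (Odd k → ∀ i : ℕ, ((p : ℤ) ^ i) • cA n ∈ AddSubgroup.closure
          (((((Finset.Ioc k K).filter (fun j ↦ Odd j)).image sA : Finset VA) : Set VA) ∪
            wA '' ((((Finset.Ioc k K).filter (fun j ↦ Odd j)).image sA : Finset VA) : Set VA)) →
        (M - M₀) + ∑ j ∈ Finset.Ioc 0 k, N j ≤ i) := by
  induction k with
  | zero =>
    refine ⟨1, kolSupp_one _, by simp, by simp, fun _ i hi ↦ ?_, fun h ↦ ?_⟩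
    · rw [c_one, smul_smul, ← pow_add] at hi
      have h0 := zsmul_eq_zero_of_mem_closure_of_indep wB sB _ x hindB subset_rfl hi
      have := le_of_pow_zsmul_eq_zero x_ord h0
      simp only [Finset.Ioc_self, Finset.sum_empty, add_zero]
      omega
    · exact absurd h (by simp)
  | succ k ih =>
    obtain ⟨n, hn, hcard, hAq, hIB, hIA⟩ := ih (by omega)
    have hk1 : k + 1 ∈ Finset.Ioc 0 K := by simp only [Finset.mem_Ioc]; omega
    have hsub : Finset.Ioc (k + 1) K ⊆ Finset.Ioc k K :=
      Finset.Ioc_subset_Ioc_left (Nat.le_succ k)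
    -- admissibility / Selmer membership of the pools of later lifts
    have hpoolA : ∀ I : Finset ℕ, (((I.image sA : Finset VA)) : Set VA) ⊆ AdmA := by
      intro I v hv
      rw [Finset.coe_image, Set.mem_image] at hv
      obtain ⟨i, -, rfl⟩ := hv
      exact sA_adm i
    have hpoolB : ∀ I : Finset ℕ, (((I.image sB : Finset VB)) : Set VB) ⊆ AdmB := by
      intro I v hv
      rw [Finset.coe_image, Set.mem_image] at hv
      obtain ⟨i, -, rfl⟩ := hv
      exact sB_adm i
    have hselpoolA : ∀ I : Finset ℕ, (((I.image sA : Finset VA)) : Set VA) ⊆ SelA := by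
      intro I v hv
      rw [Finset.coe_image, Set.mem_image] at hv
      obtain ⟨i, -, rfl⟩ := hv
      exact hselA i
    have hselpoolB : ∀ I : Finset ℕ, (((I.image sB : Finset VB)) : Set VB) ⊆ SelB := by
      intro I v hv
      rw [Finset.coe_image, Set.mem_image] at hv
      obtain ⟨i, -, rfl⟩ := hv
      exact hselB i
    -- plain `𝒪`-independence of the `B`-lifts (drop the `x`-terms)
    have hindB' : ∀ (α β : ℕ → ℤ),
        ∑ j ∈ (Finset.Ioc 0 K).filter (fun j ↦ Even j), (α j • sB j + β j • wB (sB j)) = 0 →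
          ∀ j ∈ (Finset.Ioc 0 K).filter (fun j ↦ Even j), α j • sB j + β j • wB (sB j) = 0 :=
      fun α β h ↦ (hindB 0 0 α β (by simpa using h)).2
    -- the new level `ℓ n` and its prime factors
    have hnew : ∀ {ℓ : ℕ}, Kol ℓ → ¬ ℓ ∣ n → ∀ q ∈ (ℓ * n).primeFactors, q = ℓ ∨ q ∈ n.primeFactors := by
      intro ℓ hℓ hnd q hq
      have hℓp := prime_of_kol ℓ hℓ
      rwa [Nat.primeFactors_mul hℓp.ne_zero hn.1.ne_zero, Finset.mem_union, hℓp.primeFactors,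
        Finset.mem_singleton] at hq
    rcases Nat.even_or_odd k with hke | hko
    · -- ### `k` even: current curve `B`, next curve `A`, next lift `s_A (k+1)`
      have hko1 : Odd (k + 1) := hke.add_one
      have hke1 : ¬ Even (k + 1) := Nat.not_even_iff_odd.mpr hko1
      have hn_even : Even n.primeFactors.card := hcard ▸ hke
      obtain ⟨ℓ, -, hℓ, hndvd, hTcA, hTnA, hI⟩ := coupledStep (p := p) (M := M) (M₀ := κ)
        mem_selA_iff wB wA hwSelA PA hn (cB n) (fun ℓ ↦ cA (ℓ * n))
        (fun ℓ hℓ hnd a ↦ flipA ℓ n hℓ (kolSupp_mul_of_prime_not_dvd (prime_of_kol ℓ hℓ) hℓ hn hnd) hn_even a)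
        (fun ℓ hℓ hnd ↦ hCTVA ℓ n hℓ (kolSupp_mul_of_prime_not_dvd (prime_of_kol ℓ hℓ) hℓ hn hnd) hnd hn_even)
        (((Finset.Ioc k K).filter (fun j ↦ Even j)).image sB)
        (((Finset.Ioc (k + 1) K).filter (fun j ↦ Odd j)).image sA) (sA (k + 1))
        (fun b ↦ by
          obtain ⟨ℓ, h1, h2, h3, h4⟩ := hCeb _ _ (sA (k + 1)) (cB n) (sA_adm _)
            (cB_adm n hn hn_even) (hpoolA _) (hpoolB _) b
          exact ⟨ℓ, h1, h2, h4, h3⟩)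
        (hselpoolA _) (hselA _) (hNA _ hko1) (hNA' _ hk1 hko1) (hroom _ hk1)
        (fun q hq ↦ (hAq q hq).1 (k + 1) (by simp only [Finset.mem_Ioc]; omega) hko1)
        (fun t ht ↦ by
          have ht' := ht
          rw [Finset.coe_image, Set.mem_image] at ht'
          obtain ⟨i, hi, rfl⟩ := ht'
          rw [Finset.mem_coe, Finset.mem_filter] at hi
          exact hisoA i (k + 1) hi.2 hko1)
        (fun a ha ↦ zsmul_eq_zero_of_mem_closure_of_indep' wA sA _ hindA
          (Finset.mem_filter.mpr ⟨hk1, hko1⟩)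
          (Finset.filter_subset_filter _ (Finset.Ioc_subset_Ioc_left (Nat.zero_le _)))
          (by simp) ha)
        (B₀ := (M - M₀) + ∑ j ∈ Finset.Ioc 0 k, N j)
        (le_trans (Nat.sub_le_sub_left hκ M) (Nat.le_add_right _ _)) (hIB hke)
      refine ⟨ℓ * n, (kolSupp_mul_of_prime_not_dvd (prime_of_kol ℓ hℓ) hℓ hn hndvd),
        by rw [SplitDataM.card_primeFactors_mul_of_not_dvd (prime_of_kol ℓ hℓ) hn.1.ne_zero hndvd, hcard], fun q hq ↦ ?_,
        fun h ↦ (hke1 h).elim, fun _ i hi ↦ ?_⟩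
      · rcases hnew hℓ hndvd q hq with rfl | hq
        · refine ⟨fun j hj hjo ↦ hTnA _ ?_, fun j hj hje ↦ hTcA _ ?_⟩
          · exact Finset.mem_image_of_mem _ (Finset.mem_filter.mpr ⟨hj, hjo⟩)
          · exact Finset.mem_image_of_mem _ (Finset.mem_filter.mpr ⟨hsub hj, hje⟩)
        · exact ⟨fun j hj hjo ↦ (hAq q hq).1 j (hsub hj) hjo, fun j hj hje ↦ (hAq q hq).2 j (hsub hj) hje⟩
      · rw [Finset.sum_Ioc_succ_top (Nat.zero_le k), ← add_assoc]
        exact hI i hi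
    · -- ### `k` odd: current curve `A`, next curve `B`, next lift `s_B (k+1)`
      have hke1 : Even (k + 1) := hko.add_one
      have hko1 : ¬ Odd (k + 1) := Nat.not_odd_iff_even.mpr hke1
      have hn_odd : Odd n.primeFactors.card := hcard ▸ hko
      obtain ⟨ℓ, -, hℓ, hndvd, hTcA, hTnA, hI⟩ := coupledStep (p := p) (M := M) (M₀ := κ)
        mem_selB_iff wA wB hwSelB PB hn (cA n) (fun ℓ ↦ cB (ℓ * n))
        (fun ℓ hℓ hnd a ↦ flipB ℓ n hℓ (kolSupp_mul_of_prime_not_dvd (prime_of_kol ℓ hℓ) hℓ hn hnd) hn_odd a)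
        (fun ℓ hℓ hnd ↦ hCTVB ℓ n hℓ (kolSupp_mul_of_prime_not_dvd (prime_of_kol ℓ hℓ) hℓ hn hnd) hnd hn_odd)
        (((Finset.Ioc k K).filter (fun j ↦ Odd j)).image sA)
        (((Finset.Ioc (k + 1) K).filter (fun j ↦ Even j)).image sB) (sB (k + 1))
        (fun b ↦ hCeb _ _ (cA n) (sB (k + 1)) (cA_adm n hn hn_odd) (sB_adm _) (hpoolA _) (hpoolB _) b)
        (hselpoolB _) (hselB _) (hNB _ hke1) (hNB' _ hk1 hke1) (hroom _ hk1)
        (fun q hq ↦ (hAq q hq).2 (k + 1) (by simp only [Finset.mem_Ioc]; omega) hke1)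
        (fun t ht ↦ by
          have ht' := ht
          rw [Finset.coe_image, Set.mem_image] at ht'
          obtain ⟨i, hi, rfl⟩ := ht'
          rw [Finset.mem_coe, Finset.mem_filter] at hi
          exact hisoB i (k + 1) hi.2 hke1)
        (fun a ha ↦ zsmul_eq_zero_of_mem_closure_of_indep' wB sB _ hindB'
          (Finset.mem_filter.mpr ⟨hk1, hke1⟩)
          (Finset.filter_subset_filter _ (Finset.Ioc_subset_Ioc_left (Nat.zero_le _)))
          (by simp) ha)
        (B₀ := (M - M₀) + ∑ j ∈ Finset.Ioc 0 k, N j)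
        (le_trans (Nat.sub_le_sub_left hκ M) (Nat.le_add_right _ _)) (hIA hko)
      refine ⟨ℓ * n, (kolSupp_mul_of_prime_not_dvd (prime_of_kol ℓ hℓ) hℓ hn hndvd),
        by rw [SplitDataM.card_primeFactors_mul_of_not_dvd (prime_of_kol ℓ hℓ) hn.1.ne_zero hndvd, hcard], fun q hq ↦ ?_,
        fun _ i hi ↦ ?_, fun h ↦ (hko1 h).elim⟩
      · rcases hnew hℓ hndvd q hq with rfl | hq
        · refine ⟨fun j hj hjo ↦ hTcA _ ?_, fun j hj hje ↦ hTnA _ ?_⟩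
          · exact Finset.mem_image_of_mem _ (Finset.mem_filter.mpr ⟨hsub hj, hjo⟩)
          · exact Finset.mem_image_of_mem _ (Finset.mem_filter.mpr ⟨hj, hje⟩)
        · exact ⟨fun j hj hjo ↦ (hAq q hq).1 j (hsub hj) hjo, fun j hj hje ↦ (hAq q hq).2 j (hsub hj) hje⟩
      · rw [Finset.sum_Ioc_succ_top (Nat.zero_le k), ← add_assoc]
        exact hI i hi

/-! ## §3κ. THEOREM K3, "≤" half: `∑ N_i ≤ M₀` (κ-narrowed leaves) -/

/-- **THEOREM K3's "≤" half = Kolyvagin's order inequality in the coupled form (memo two §64.5 / McCallum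
1991, §1 Theorem with Thm. 5.4 "≤" and Cor. 5.6), telescope version, WITHOUT Prop. 5.2′, κ-NARROWED value
clauses** (variant of p694742's `sum_le_M₀_of_coupledCasselsTate`).  Under the data of
`exists_coupledChain_of_casselsTate_kappa`, **`∑_{i=1}^{K} N_i ≤ M₀`**.  For the lifts `s_i` of
`𝒪`-generators `d_i` of a maximal isotropic `D^A ⊕ D^B = ⊕_i 𝒪·d_i` of `Ш(A/K)[2^∞] ⊕ Ш(B/K)[2^∞]`
(`A`-summands at odd `i`, `B`-summands at even `i`, memo §64.5 SET-UP; empty summands allowed) this is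
`∑ N_i ≤ M₀ = m`, whence `#(Ш(A/K)[2^∞] ⊕ Ш(B/K)[2^∞]) = (#D)² = 16^{∑N_i} ≤ 16^{m}`, i.e. the TAIL
`s_A + s_B = 2∑N_i ≤ 2m` of `stub_tailFour` in memo §57.2's pair currency.  The proof is the chain of
`exists_coupledChain_of_casselsTate_kappa` at `k = K` applied to `i = M` (`p^M c(n_K) = 0`).
[cite: McCallumLMS1991, §1 Theorem; Thm. 5.4 (proof), Cor. 5.6; Prop. 3.1, Prop. 4.7, Lemma 5.3] -/
theorem sum_le_M₀_of_coupledCasselsTate_kappa {p : ℕ} {M M₀ : ℕ} {Kol : ℕ → Prop}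
    (prime_of_kol : ∀ ℓ, Kol ℓ → ℓ.Prime) {pl : ℕ → Pl}
    (torsionA : ∀ v : VA, ((p : ℤ) ^ M) • v = 0) (torsionB : ∀ v : VB, ((p : ℤ) ^ M) • v = 0)
    {SelA : AddSubgroup VA} {SelB : AddSubgroup VB} {LocA : Pl → AddSubgroup VA}
    {LocB : Pl → AddSubgroup VB} (mem_selA_iff : ∀ s, s ∈ SelA ↔ ∀ v, s ∈ LocA v)
    (mem_selB_iff : ∀ s, s ∈ SelB ↔ ∀ v, s ∈ LocB v) {AA : ℕ → AddSubgroup VA}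
    {AB : ℕ → AddSubgroup VB} (wA : VA →+ VA) (wB : VB →+ VB) (hwSelA : ∀ s ∈ SelA, wA s ∈ SelA)
    (hwSelB : ∀ s ∈ SelB, wB s ∈ SelB) {AdmA : Set VA} {AdmB : Set VB}
    {x : VB} (x_ord : ((p : ℤ) ^ (M - 1)) • x ≠ 0) {cA : ℕ → VA} {cB : ℕ → VB}
    (c_one : cB 1 = ((p : ℤ) ^ M₀) • x) {κ : ℕ} (hκ : M₀ ≤ κ)
    (cA_adm : ∀ n, KolSupp Kol n → Odd n.primeFactors.card → cA n ∈ AdmA)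
    (cB_adm : ∀ n, KolSupp Kol n → Even n.primeFactors.card → cB n ∈ AdmB)
    (flipA : ∀ ℓ m, Kol ℓ → KolSupp Kol (ℓ * m) → Even m.primeFactors.card → ∀ a : ℕ,
      ((p : ℤ) ^ a) • cA (ℓ * m) ∈ LocA (pl ℓ) ↔ ((p : ℤ) ^ a) • cB m ∈ AB ℓ)
    (flipB : ∀ ℓ m, Kol ℓ → KolSupp Kol (ℓ * m) → Odd m.primeFactors.card → ∀ a : ℕ,
      ((p : ℤ) ^ a) • cB (ℓ * m) ∈ LocB (pl ℓ) ↔ ((p : ℤ) ^ a) • cA m ∈ AA ℓ)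
    (PA : SelA →+ SelA →+ RA) (PB : SelB →+ SelB →+ RB)
    (hCTVA : ∀ ℓ m : ℕ, Kol ℓ → KolSupp Kol (ℓ * m) → ¬ ℓ ∣ m → Even m.primeFactors.card →
      ∀ (j N a b : ℕ) (t : VA) (ht : t ∈ SelA) (hz : ((p : ℤ) ^ j) • cA (ℓ * m) ∈ SelA),
      ((p : ℤ) ^ N) • t = 0 → (∀ q ∈ m.primeFactors, t ∈ AA q) → M - κ ≤ j → N + κ ≤ M → N ≤ j →
      a + b + 1 = N → ((p : ℤ) ^ (a + (j - N))) • cB m ∉ AB ℓ → ((p : ℤ) ^ b) • t ∉ AA ℓ →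
      PA ⟨_, hz⟩ ⟨t, ht⟩ ≠ 0)
    (hCTVB : ∀ ℓ m : ℕ, Kol ℓ → KolSupp Kol (ℓ * m) → ¬ ℓ ∣ m → Odd m.primeFactors.card →
      ∀ (j N a b : ℕ) (t : VB) (ht : t ∈ SelB) (hz : ((p : ℤ) ^ j) • cB (ℓ * m) ∈ SelB),
      ((p : ℤ) ^ N) • t = 0 → (∀ q ∈ m.primeFactors, t ∈ AB q) → M - κ ≤ j → N + κ ≤ M → N ≤ j →
      a + b + 1 = N → ((p : ℤ) ^ (a + (j - N))) • cA m ∉ AA ℓ → ((p : ℤ) ^ b) • t ∉ AB ℓ →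
      PB ⟨_, hz⟩ ⟨t, ht⟩ ≠ 0)
    (hCeb : ∀ (TA : Finset VA) (TB : Finset VB) (gA : VA) (gB : VB), gA ∈ AdmA → gB ∈ AdmB →
      (TA : Set VA) ⊆ AdmA → (TB : Set VB) ⊆ AdmB → ∀ b : ℕ, ∃ ℓ, b < ℓ ∧ Kol ℓ ∧
      (∀ g ∈ AddSubgroup.closure (insert gA (insert (wA gA) ((TA : Set VA) ∪ wA '' (TA : Set VA)))),
        g ∈ AA ℓ ↔ g ∈ AddSubgroup.closure ((TA : Set VA) ∪ wA '' (TA : Set VA))) ∧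
      (∀ g ∈ AddSubgroup.closure (insert gB (insert (wB gB) ((TB : Set VB) ∪ wB '' (TB : Set VB)))),
        g ∈ AB ℓ ↔ g ∈ AddSubgroup.closure ((TB : Set VB) ∪ wB '' (TB : Set VB))))
    (K : ℕ) (sA : ℕ → VA) (sB : ℕ → VB) (N : ℕ → ℕ) (hselA : ∀ i, sA i ∈ SelA)
    (hselB : ∀ i, sB i ∈ SelB) (sA_adm : ∀ i, sA i ∈ AdmA) (sB_adm : ∀ i, sB i ∈ AdmB)
    (hNA : ∀ i, Odd i → ((p : ℤ) ^ N i) • sA i = 0) (hNB : ∀ i, Even i → ((p : ℤ) ^ N i) • sB i = 0)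
    (hNA' : ∀ i ∈ Finset.Ioc 0 K, Odd i → N i ≠ 0 → ((p : ℤ) ^ (N i - 1)) • sA i ≠ 0)
    (hNB' : ∀ i ∈ Finset.Ioc 0 K, Even i → N i ≠ 0 → ((p : ℤ) ^ (N i - 1)) • sB i ≠ 0)
    (hroom : ∀ i ∈ Finset.Ioc 0 K, N i + κ ≤ M)
    (hisoA : ∀ i i', Odd i → Odd i' →
      PA ⟨sA i, hselA i⟩ ⟨sA i', hselA i'⟩ = 0 ∧ PA ⟨wA (sA i), hwSelA _ (hselA i)⟩ ⟨sA i', hselA i'⟩ = 0)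
    (hisoB : ∀ i i', Even i → Even i' →
      PB ⟨sB i, hselB i⟩ ⟨sB i', hselB i'⟩ = 0 ∧ PB ⟨wB (sB i), hwSelB _ (hselB i)⟩ ⟨sB i', hselB i'⟩ = 0)
    (hindA : ∀ (α β : ℕ → ℤ),
      ∑ j ∈ (Finset.Ioc 0 K).filter (fun j ↦ Odd j), (α j • sA j + β j • wA (sA j)) = 0 →
        ∀ j ∈ (Finset.Ioc 0 K).filter (fun j ↦ Odd j), α j • sA j + β j • wA (sA j) = 0)
    (hindB : ∀ (b c : ℤ) (α β : ℕ → ℤ),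
      (b • x + c • wB x) +
          ∑ j ∈ (Finset.Ioc 0 K).filter (fun j ↦ Even j), (α j • sB j + β j • wB (sB j)) = 0 →
        b • x + c • wB x = 0 ∧
          ∀ j ∈ (Finset.Ioc 0 K).filter (fun j ↦ Even j), α j • sB j + β j • wB (sB j) = 0) :
    ∑ i ∈ Finset.Ioc 0 K, N i ≤ M₀ := by
  obtain ⟨n, -, -, -, hIB, hIA⟩ := exists_coupledChain_of_casselsTate_kappa prime_of_kol mem_selA_iff
    mem_selB_iff wA wB hwSelA hwSelB x_ord c_one hκ cA_adm cB_adm flipA flipB PA PB hCTVA hCTVB hCeb K sA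
    sB N hselA hselB sA_adm sB_adm hNA hNB hNA' hNB' hroom hisoA hisoB hindA hindB K le_rfl
  rcases Nat.even_or_odd K with hK | hK
  · have := hIB hK M (by rw [torsionB]; exact zero_mem _)
    omega
  · have := hIA hK M (by rw [torsionA]; exact zero_mem _)
    omega

end ChainKappa

end Summit.BirchSwinnertonDyer.BirchSwinnertonDyer.Theorems.SylvesterTwoCoupledTelescope
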